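import Summits.QuantumFields.BalabanUV.Beta.D1BFx.AssemblyEndRecutS
import Summits.QuantumFields.BalabanUV.Beta.D1BFx.RestTotalOfWords

/-!
# `BalabanUV.Beta.D1BFx.RestTotalOfWordsS` — road «BF-x» for binder row D1: the TOTAL off-corner rest bound FROM per-word bounds, TWO-PROFILE RE-CUT
# TABLE, variant «ENDₛ» (END-ii-SPEC v1.1 §3 (b), chain glue): `RestTotalOfWords` verbatim with `restK' (gp b) ↦ restKS (gp b) (s•gp b)` and
# `conv_recut ↦ AssemblyEndRecutS.conv_recutS`

HONEST DEPENDENCY (page 1, mandatory): continuum YM on T⁴ ⇐ BetaPertH ∧ nine spine estimates (0/9 proved); BetaPertH ⇐ (D1) ∧ (D4) ∧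
CAP+tail; G-an2-4 gates asym, D1 and NE2/3/4.  HONEST FRAMING (cell contract, verbatim): «discharging `BetaPertH` makes Bałaban's UV
stability UNCONDITIONAL — a real constructive-QFT result; it is NOT the continuum limit and NOT the Clay problem.»  THIS MODULE DISCHARGES
NOTHING of the wall: [folklore] triangle inequality + `Assembly.fullSum_finset_sum` over the (CONV) theorem `AssemblyEndRecutS.conv_recutS` for the
two-profile words; no `def`, no `Prop` minted, nothing cited, 0 sorry.  0 wall binders; NOT (K), NOT D1, NOT `BetaPertH`, NOT continuum, NOT Clay.

ABSOLUTE RULE (cell charter, verbatim): «No internally-minted statement may enter as a cited fact. Every hypothesis is either kernel-proved in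
this package or a verbatim quotation of a PUBLISHED theorem with page reference. The manuscript(s) under audit are NOT citable for their own
disputed steps — they are the thing under adjudication; programme-internal (2001/route/tribunal) claims are never citable.»

CONTENT.
* §1 [folklore] **`restTot_of_perWordS`** (fixed block size, scalar `s`).  §2 **`hRestTot_of_hRestS`** (along the block sizes, family `s : ℕ → ℝ`, frozen
  profile `gfrz`, pinned normalisation).
Unit `b2b-balaban-beta-d1-p2` (road owner, gen 12); `LEAVES-BFx.md` row A7-ENDₛ (glue); END-ii-SPEC v1.1 §3 (b).
-/

noncomputable section

open Finset Filter Topology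
open scoped BigOperators
open Literature.MathematicalPhysics.QuantumFieldTheory.Balaban1983to89
open Literature.MathematicalPhysics.QuantumFieldTheory.Balaban1983to89.Beta
open WindowIdentification (fullSum psum)
open B12Sec2to5 (l1)
open DyadicShell (Pt)
open ExpKernelCalculus (Site MKer BiLoc)
open DressedMomentNormalisation (resSite)
open Summit.QuantumFields.BalabanUV.Beta.TameKernelCalculus (Spr)
open Summit.QuantumFields.BalabanUV.Beta.D1BFx.GluonLeg (Ga)
open Summit.QuantumFields.BalabanUV.Beta.D1BFx.ReducedKernel (TableR)
open Summit.QuantumFields.BalabanUV.Beta.D1BFx.FrozenLegProfile (gfrz decay_gfrz)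
open Summit.QuantumFields.BalabanUV.Beta.D1BFx.SplitInstance (RestIdx)
open Summit.QuantumFields.BalabanUV.Beta.D1BFx.SplitInstanceS (restKS)
open Summit.QuantumFields.BalabanUV.Beta.D1BFx.Assembly (fullSum_finset_sum)
open Summit.QuantumFields.BalabanUV.Beta.D1BFx.AssemblyEndRecutS (conv_recutS)
open Summit.QuantumFields.BalabanUV.Beta.D1BFx.RoadEndBFxRecut (cornerIdx)

namespace Summit.QuantumFields.BalabanUV.Beta.D1BFx.RestTotalOfWordsS

/-! ## §1 At one block size -/

section Fixed

variable (n : ℕ) [NeZero n] (a : ℝ) {gp : Pt → Pt → ℝ} (cE cΛ cR cK cQ cE₂ cJ4 cΛ₂ cR₂ cQ₂ x₀ ωgl ωgh lam N : ℝ) {WE WJ WΛ WR WQ : TableR}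
  {μ ν : Fin 4} {C δ CE CJ CΛt CRt CQ δW : ℝ} {CR : RestIdx → ℝ}

/-- [folklore] **PER-WORD BOUNDS IMPLY THE TOTAL OFF-CORNER BOUND, TWO-PROFILE TABLE** (`restKS (gp b) (s•gp b)`, any scalar `s`) at a fixed block size (site-dependent profile `gp b` exponentially bounded; `0 < a`,
`Spr (Ga n a)`, the five slot tables bi-localised at one rate, `μ ≠ ν` — the (CONV) data of `AssemblyEndRecut.conv_recut`). -/
theorem restTot_of_perWordS (ha : 0 < a) (hGa : Spr (Ga n a))
    (hg : ∀ b : Pt, ∃ C δ : ℝ, 0 < δ ∧ ∀ v, |gp b v| ≤ C * Real.exp (-δ * l1 v)) (hδW : 0 < δW)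
    (hE : ∀ κ u l u', BiLoc (WE κ u l u') u u' CE δW) (hJ : ∀ κ u l u', BiLoc (WJ κ u l u') u u' CJ δW)
    (hΛ : ∀ κ u l u', BiLoc (WΛ κ u l u') u u' CΛt δW) (hR : ∀ κ u l u', BiLoc (WR κ u l u') u u' CRt δW)
    (hQ : ∀ κ u l u', BiLoc (WQ κ u l u') u u' CQ δW) (hμν : μ ≠ ν) (s : ℝ)
    (hRest : ∀ τ : RestIdx, τ ≠ cornerIdx → |∑ b ∈ (univ : Finset (Fin 4 → Fin n)).image resSite, ((n : ℝ) ^ 4)⁻¹ *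
      fullSum (fun w : Pt => restKS n a (gp b) (fun v => s * gp b v) cE cΛ cR cK cQ cE₂ cJ4 cΛ₂ cR₂ cQ₂ x₀ WE WJ WΛ WR WQ ωgl ωgh lam N μ ν b τ w)| ≤ CR τ) :
    |∑ b ∈ (univ : Finset (Fin 4 → Fin n)).image resSite, ((n : ℝ) ^ 4)⁻¹ *
      fullSum (fun w : Pt => ∑ τ ∈ (univ : Finset RestIdx).erase cornerIdx,
        restKS n a (gp b) (fun v => s * gp b v) cE cΛ cR cK cQ cE₂ cJ4 cΛ₂ cR₂ cQ₂ x₀ WE WJ WΛ WR WQ ωgl ωgh lam N μ ν b τ w)|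
      ≤ ∑ τ ∈ (univ : Finset RestIdx).erase cornerIdx, CR τ := by
  -- distribute the full sum over the finite word set (every word converges), then swap the two finite sums
  have hfs : ∀ b ∈ (univ : Finset (Fin 4 → Fin n)).image resSite,
      fullSum (fun w : Pt => ∑ τ ∈ (univ : Finset RestIdx).erase cornerIdx,
        restKS n a (gp b) (fun v => s * gp b v) cE cΛ cR cK cQ cE₂ cJ4 cΛ₂ cR₂ cQ₂ x₀ WE WJ WΛ WR WQ ωgl ωgh lam N μ ν b τ w)
      = ∑ τ ∈ (univ : Finset RestIdx).erase cornerIdx,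
          fullSum (restKS n a (gp b) (fun v => s * gp b v) cE cΛ cR cK cQ cE₂ cJ4 cΛ₂ cR₂ cQ₂ x₀ WE WJ WΛ WR WQ ωgl ωgh lam N μ ν b τ) := by
    intro b _
    obtain ⟨C', δ', hδ', hgb⟩ := hg b
    exact fullSum_finset_sum _ fun τ _ =>
      conv_recutS n a cE cΛ cR cK cQ cE₂ cJ4 cΛ₂ cR₂ cQ₂ x₀ ωgl ωgh lam N b ha hGa hδ' hgb hδW hE hJ hΛ hR hQ hμν s τ
  rw [sum_congr rfl fun b hb => by rw [hfs b hb, mul_sum], sum_comm]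
  refine (abs_sum_le_sum_abs _ _).trans (sum_le_sum fun τ hτ => ?_)
  exact hRest τ (ne_of_mem_erase hτ)

end Fixed

/-! ## §2 Packaged along the block sizes, at the frozen profile and the pinned normalisation -/

section Packaged

variable {a N : ℝ} {μ ν : Fin 4} {cE cΛ cR cK cQ cE₂ cJ4 cΛ₂ cR₂ cQ₂ x₀ ωgl ωgh : ℕ → ℝ} {WE WJ WΛ WR WQ : ℕ → TableR}
  {CE CJ CΛt CRt CQ δW : ℕ → ℝ} {CR : RestIdx → ℝ}

/-- [folklore] **THE `hRest` FAMILY OF `RoadEndBFxRecutS.d1Drift_BFx_recutS` IMPLIES THE `hRestTot` HYPOTHESIS OF THE «ENDₛ» TOTAL-REST ENDs** (`RoadEndBFxTotalShellS`; two-profile words `restKS (gfrz n a b) (s n • gfrz n a b)`, any scalar family `s`)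
with `CRtot := Σ_{τ ≠ cornerIdx} CR τ` (given the ENDs' common data `0 < a`, `Spr (Ga n a)`, the slot-table localisation, `μ ≠ ν`). -/
theorem hRestTot_of_hRestS (ha : 0 < a) (hμν : μ ≠ ν) (hGa : ∀ n : ℕ, 2 ≤ n → ∀ [NeZero n], Spr (Ga n a)) (hδW : ∀ n, 0 < δW n)
    (hE : ∀ n κ u l u', BiLoc (WE n κ u l u') u u' (CE n) (δW n)) (hJ : ∀ n κ u l u', BiLoc (WJ n κ u l u') u u' (CJ n) (δW n))
    (hΛ : ∀ n κ u l u', BiLoc (WΛ n κ u l u') u u' (CΛt n) (δW n)) (hR : ∀ n κ u l u', BiLoc (WR n κ u l u') u u' (CRt n) (δW n))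
    (hQ : ∀ n κ u l u', BiLoc (WQ n κ u l u') u u' (CQ n) (δW n)) (s : ℕ → ℝ)
    (hRest : ∀ n : ℕ, 2 ≤ n → ∀ [NeZero n], ∀ τ : RestIdx, τ ≠ cornerIdx →
      |∑ b ∈ (univ : Finset (Fin 4 → Fin n)).image resSite, ((n : ℝ) ^ 4)⁻¹ *
        fullSum (fun w : Pt => restKS n a (gfrz n a b) (fun v => s n * gfrz n a b v) (cE n) (cΛ n) (cR n) (cK n) (cQ n) (cE₂ n) (cJ4 n) (cΛ₂ n) (cR₂ n) (cQ₂ n) (x₀ n)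
          (WE n) (WJ n) (WΛ n) (WR n) (WQ n) (ωgl n) (ωgh n) ((n : ℝ) ^ 8) N μ ν b τ w)| ≤ CR τ) :
    ∀ n : ℕ, 2 ≤ n → ∀ [NeZero n],
      |∑ b ∈ (univ : Finset (Fin 4 → Fin n)).image resSite, ((n : ℝ) ^ 4)⁻¹ *
        fullSum (fun w : Pt => ∑ τ ∈ (univ : Finset RestIdx).erase cornerIdx,
          restKS n a (gfrz n a b) (fun v => s n * gfrz n a b v) (cE n) (cΛ n) (cR n) (cK n) (cQ n) (cE₂ n) (cJ4 n) (cΛ₂ n) (cR₂ n) (cQ₂ n) (x₀ n)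
            (WE n) (WJ n) (WΛ n) (WR n) (WQ n) (ωgl n) (ωgh n) ((n : ℝ) ^ 8) N μ ν b τ w)|
        ≤ ∑ τ ∈ (univ : Finset RestIdx).erase cornerIdx, CR τ := by
  intro n hn _
  exact restTot_of_perWordS n a (cE n) (cΛ n) (cR n) (cK n) (cQ n) (cE₂ n) (cJ4 n) (cΛ₂ n) (cR₂ n) (cQ₂ n) (x₀ n) (ωgl n) (ωgh n)
    ((n : ℝ) ^ 8) N ha (hGa n hn) (fun b => decay_gfrz (hGa n hn) b) (hδW n) (hE n) (hJ n) (hΛ n) (hR n) (hQ n) hμν (s n) (hRest n hn)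

end Packaged

end Summit.QuantumFields.BalabanUV.Beta.D1BFx.RestTotalOfWordsS

end
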